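import Summits.Ventures.PercRepro.RankLevelSetHallRuleLUniformTools

/-!
# PercRepro — RULE L PAYS EVERY MEMBER WHOSE BIG SETS HAVE `k`-BOUNDED ELIGIBILITY (p4, gen 30; C-044, UP form at the
tight layer; paper proofs/P4-CELL-THREE.md §14.12–14.13)

The uniform-flat theorem (RankLevelSetHallRuleLUniform) uses ONE free set `X_D` and the bound `eligCount S ≤ C(q + #X_P, q)`
on the big sets `S = Z ∪ X_P ∪ X_D`.  THIS FILE spends the factor `k = p − q` that the uniform case leaves on the table: with a
free set `B ⊆ E ∖ cl Z` of size `k` (`Z ∪ B` independent; `exists_free_indep`) the `k` sets `Y ⊆ B` of size `k − 1` give `k`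
disjoint families `S(X_P, Y) = Z ∪ X_P ∪ Y`, and if on every one of them `eligCount S ≤ c · C(q + #X_P, q)` with `c ≤ k`
(«`c`-bounded eligibility»), then `ruleLBig Z ≥ (k / c) · Σ_{∅ ≠ X_P ⊆ P} 1/C(q + #X_P, q) ≥ δ(Z)` and Rule L pays `Z`.
This is the statement to verify on a PAVING flat (every `≤ (q−1)`-subset of `cl Z` independent): there the eligible members
of `S` are the `q`-subsets of `Z ∪ X_P` and the pairs (a `(q−1)`-subset of a circuit-hyperplane of `M|(Z ∪ X_P)`, a point of
`Y`), so `eligCount S ≤ C(q + a, q) + (k − 1)·q·#CH(Z ∪ X_P)` and `c = k` holds whenever `q·#CH(Z ∪ X_P) ≤ C(q + a, q)`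
(paper §14.13).  The uniform case is `c = 1`.
* `bigSet_cond` — `Z ∪ X_P ∪ X_D` (`X_P ≠ ∅`, `X_D` free of size `p − q − 1`) is a big `Y`-set in which `Z` is eligible;
* **`lymDefect_le_ruleLBig_of_bound`** — `δ(Z) ≤ ruleLBig Z` under `c`-bounded eligibility, `1 ≤ c ≤ p − q`;
* **`ruleL_pays_of_bound`** — `Φ(p,q) ≤ ruleLRecv Z` under the same hypothesis.
Axioms standard.
-/

namespace PercRepro

open Set Matroid Finset

variable {α : Type} (M : Matroid α) [M.Finite]

/-- For a member `Z`, a free set `X_D ⊆ E ∖ cl Z` of size `p − q − 1` with `Z ∪ X_D` independent and a nonempty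
`X_P ⊆ flatPart Z`, the set `S = Z ∪ X_P ∪ X_D` is a `Y`-set with `#S = q + #X_P + (p − q − 1) ≥ p` in which `Z` is
eligible. -/
lemma bigSet_cond {p q : ℕ} (hE : M.E.ncard = p + q) (hpq : q + 2 ≤ p) {Z : Set α} (hZ : Z ∈ cellMembers M p q)
    {X_D : Set α} (hXD : X_D ⊆ M.E \ M.closure Z) (hXDcard : X_D.ncard = p - q - 1) (hZXD : M.Indep (Z ∪ X_D))
    {X_P : Set α} (hXP : X_P ⊆ flatPart M Z) (hne : X_P.Nonempty) :
    (Z ∪ X_P ∪ X_D) ∈ cellY M p q ∧ (Z ∪ X_P ∪ X_D).ncard = q + X_P.ncard + (p - q - 1) ∧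
      (Z ⊆ Z ∪ X_P ∪ X_D ∧ ¬ (Z ∪ X_P ∪ X_D).ncard < p ∧
        (∃ e ∈ Z ∪ X_P ∪ X_D, e ∉ Z ∧ M.eRk (insert e Z) = (q : ℕ∞))) := by
  have hZE : Z ⊆ M.E := hZ.1
  have hEfin : M.E.Finite := M.ground_finite
  have hZfin : Z.Finite := hEfin.subset hZE
  have hZcard : Z.ncard = q := ncard_eq_q_of_mem_cellMembers_tight M hE hZ
  have hqZ : M.eRk Z = (q : ℕ∞) := hZ.2.1
  have hXDE : X_D ⊆ M.E := fun x hx => (hXD hx).1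
  have hXDfin : X_D.Finite := hEfin.subset hXDE
  have hXPE : X_P ⊆ M.E := fun x hx => (hXP hx).1.1
  have hXPfin : X_P.Finite := hEfin.subset hXPE
  have hXPcl : X_P ⊆ M.closure Z := fun x hx => (hXP hx).2
  have hdisj1 : Disjoint Z X_P := Set.disjoint_left.2 (fun x hxZ hxX => (hXP hxX).1.2 hxZ)
  have hdisj2 : Disjoint (Z ∪ X_P) X_D := by
    rw [Set.disjoint_left]
    rintro x (hxZ | hxX) hxD
    · exact (hXD hxD).2 (M.subset_closure Z hZE hxZ)
    · exact (hXD hxD).2 (hXPcl hxX)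
  have hcard : (Z ∪ X_P ∪ X_D).ncard = q + X_P.ncard + (p - q - 1) := by
    rw [Set.ncard_union_eq hdisj2 (hZfin.union hXPfin) hXDfin, Set.ncard_union_eq hdisj1 hZfin hXPfin, hZcard, hXDcard]
  have hZXDrk : M.eRk (Z ∪ X_D) = ((q + (p - q - 1) : ℕ) : ℕ∞) := by
    rw [hZXD.eRk_eq_encard, Set.encard_union_eq (Set.disjoint_left.2
      (fun x hxZ hxD => (hXD hxD).2 (M.subset_closure Z hZE hxZ))), ← hZfin.cast_ncard_eq,
      ← hXDfin.cast_ncard_eq, hZcard, hXDcard]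
    norm_cast
  have hrk : M.eRk (Z ∪ X_P ∪ X_D) = ((q + (p - q - 1) : ℕ) : ℕ∞) := by
    apply le_antisymm
    · calc M.eRk (Z ∪ X_P ∪ X_D) ≤ M.eRk (M.closure Z ∪ X_D) := M.eRk_mono (by
            intro x hx
            rcases hx with (hxZ | hxX) | hxD
            · exact Or.inl (M.subset_closure Z hZE hxZ)
            · exact Or.inl (hXPcl hxX)
            · exact Or.inr hxD)
        _ = M.eRk (Z ∪ X_D) := M.eRk_union_closure_left_eq Z X_D
        _ = _ := hZXDrk
    · calc ((q + (p - q - 1) : ℕ) : ℕ∞) = M.eRk (Z ∪ X_D) := hZXDrk.symm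
        _ ≤ M.eRk (Z ∪ X_P ∪ X_D) := M.eRk_mono (by
            intro x hx
            rcases hx with hxZ | hxD
            · exact Or.inl (Or.inl hxZ)
            · exact Or.inr hxD)
  obtain ⟨x, hx⟩ := hne
  have hxP : x ∈ flatPart M Z := hXP hx
  have hpos : 1 ≤ X_P.ncard := by
    have : 0 < X_P.ncard := (Set.ncard_pos hXPfin).2 ⟨x, hx⟩
    omega
  refine ⟨⟨?_, ?_, ?_⟩, hcard, fun y hy => Or.inl (Or.inl hy), ?_, ⟨x, Or.inl (Or.inr hx), hxP.1.2, ?_⟩⟩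
  · intro y hy
    rcases hy with (hyZ | hyX) | hyD
    · exact hZE hyZ
    · exact hXPE hyX
    · exact hXDE hyD
  · rw [hrk]; exact_mod_cast (show q < q + (p - q - 1) by omega)
  · rw [hrk]; exact_mod_cast (show q + (p - q - 1) < p by omega)
  · rw [hcard]; omega
  · rw [← M.eRk_insert_closure_eq, Set.insert_eq_of_mem hxP.2, M.eRk_closure_eq, hqZ]

/-- **The big-set receipt covers the LYM defect under `c`-bounded eligibility**: if for EVERY free set `B ⊆ E ∖ cl Z` of
size `p − q` with `Z ∪ B` independent, every `Y ⊆ B` of size `p − q − 1` and every nonempty `X_P ⊆ flatPart Z` the big set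
`Z ∪ X_P ∪ Y` has `eligCount ≤ c · C(q + #X_P, q)`, with `1 ≤ c ≤ p − q`, then `δ(Z) ≤ ruleLBig Z`. -/
theorem lymDefect_le_ruleLBig_of_bound (p q : ℕ) (hE : M.E.ncard = p + q) (hpq : q + 2 ≤ p) {Z : Set α}
    (hZ : Z ∈ cellMembers M p q) (c : ℕ) (hc1 : 1 ≤ c) (hck : c ≤ p - q)
    (hH : ∀ B ⊆ M.E \ M.closure Z, B.ncard = p - q → M.Indep (Z ∪ B) →
      ∀ Y ⊆ B, Y.ncard = p - q - 1 → ∀ X_P ⊆ flatPart M Z, X_P.Nonempty →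
        eligCount M p q (Z ∪ X_P ∪ Y) ≤ c * (q + X_P.ncard).choose q) :
    lymDefect M p q Z ≤ ruleLBig M p q Z := by
  classical
  have hZE : Z ⊆ M.E := hZ.1
  have hEfin : M.E.Finite := M.ground_finite
  have hZfin : Z.Finite := hEfin.subset hZE
  have hZcard : Z.ncard = q := ncard_eq_q_of_mem_cellMembers_tight M hE hZ
  have hPsub : flatPart M Z ⊆ M.E \ Z := fun x hx => hx.1
  have hPfin : (flatPart M Z).Finite := (hEfin.subset Set.sdiff_subset).subset hPsub
  set m := (flatPart M Z).ncard with hm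
  set k := p - q with hk
  obtain ⟨B, hB, hBcard, hZB⟩ := exists_free_indep M hE hZ (p - q) le_rfl
  have hBE : B ⊆ M.E := fun x hx => (hB hx).1
  have hBfin : B.Finite := hEfin.subset hBE
  set Pf : Finset α := hPfin.toFinset with hPf
  set Bf : Finset α := hBfin.toFinset with hBf
  have hPfcard : Pf.card = m := by rw [hPf, ← ncard_eq_toFinset_card _ hPfin]
  have hBfcard : Bf.card = k := by rw [hBf, ← ncard_eq_toFinset_card _ hBfin, hBcard]
  -- the index set: pairs (X_P, Y)
  set I : Finset (Finset α × Finset α) :=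
    (Pf.powerset.filter (fun X => X.Nonempty)) ×ˢ Bf.powersetCard (k - 1) with hI
  let S : Finset α × Finset α → Set α := fun XY => Z ∪ (XY.1 : Set α) ∪ (XY.2 : Set α)
  have hXPsub : ∀ X : Finset α, X ⊆ Pf → (X : Set α) ⊆ flatPart M Z := by
    intro X hX x hx
    have := hX hx
    rwa [hPf, hPfin.mem_toFinset] at this
  have hYsub : ∀ Y : Finset α, Y ⊆ Bf → (Y : Set α) ⊆ M.E \ M.closure Z := by
    intro Y hY x hx
    have := hY hx
    rw [hBf, hBfin.mem_toFinset] at this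
    exact hB this
  have hYind : ∀ Y : Finset α, Y ⊆ Bf → M.Indep (Z ∪ (Y : Set α)) := by
    intro Y hY
    refine hZB.subset (Set.union_subset_union_right Z ?_)
    intro x hx
    have := hY hx
    rwa [hBf, hBfin.mem_toFinset] at this
  have hYcard : ∀ Y : Finset α, Y ∈ Bf.powersetCard (k - 1) → (Y : Set α).ncard = p - q - 1 := by
    intro Y hY
    rw [Finset.mem_powersetCard] at hY
    rw [Set.ncard_coe_finset, hY.2]
  -- every pair gives a big eligible Y-set
  have hcond : ∀ XY ∈ I, (S XY) ∈ cellY M p q ∧ (S XY).ncard = q + XY.1.card + (p - q - 1) ∧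
      (Z ⊆ S XY ∧ ¬ (S XY).ncard < p ∧ (∃ e ∈ S XY, e ∉ Z ∧ M.eRk (insert e Z) = (q : ℕ∞))) := by
    intro XY hXY
    rw [hI, Finset.mem_product, Finset.mem_filter, Finset.mem_powerset] at hXY
    have h := bigSet_cond M hE hpq hZ (hYsub XY.2 (Finset.mem_powersetCard.1 hXY.2).1) (hYcard XY.2 hXY.2)
      (hYind XY.2 (Finset.mem_powersetCard.1 hXY.2).1) (hXPsub XY.1 hXY.1.1)
      (Finset.coe_nonempty.2 hXY.1.2)
    rw [Set.ncard_coe_finset] at h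
    exact h
  -- injectivity of (X_P, Y) ↦ S
  have hinj : Set.InjOn S (I : Set (Finset α × Finset α)) := by
    intro XY₁ hXY₁ XY₂ hXY₂ heq
    rw [Finset.mem_coe, hI, Finset.mem_product, Finset.mem_filter, Finset.mem_powerset] at hXY₁ hXY₂
    have keyP : ∀ XY : Finset α × Finset α, XY.1 ⊆ Pf → XY.2 ⊆ Bf →
        ((S XY) ∩ flatPart M Z : Set α) = (XY.1 : Set α) := by
      intro XY hXP hY
      ext x
      constructor
      · rintro ⟨(hxZ | hxX) | hxY, hxP⟩
        · exact absurd hxZ hxP.1.2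
        · exact hxX
        · exact absurd hxP.2 (hYsub XY.2 hY hxY).2
      · intro hx
        exact ⟨Or.inl (Or.inr hx), hXPsub XY.1 hXP hx⟩
    have keyB : ∀ XY : Finset α × Finset α, XY.1 ⊆ Pf → XY.2 ⊆ Bf →
        ((S XY) ∩ (M.E \ M.closure Z) : Set α) = (XY.2 : Set α) := by
      intro XY hXP hY
      ext x
      constructor
      · rintro ⟨(hxZ | hxX) | hxY, hxD⟩
        · exact absurd (M.subset_closure Z hZE hxZ) hxD.2
        · exact absurd (hXPsub XY.1 hXP hxX).2 hxD.2
        · exact hxY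
      · intro hx
        exact ⟨Or.inr hx, hYsub XY.2 hY hx⟩
    have h1 : (S XY₁) ∩ flatPart M Z = (S XY₂) ∩ flatPart M Z := by rw [heq]
    have h2 : (S XY₁) ∩ (M.E \ M.closure Z) = (S XY₂) ∩ (M.E \ M.closure Z) := by rw [heq]
    rw [keyP XY₁ hXY₁.1.1 (Finset.mem_powersetCard.1 hXY₁.2).1, keyP XY₂ hXY₂.1.1
      (Finset.mem_powersetCard.1 hXY₂.2).1] at h1
    rw [keyB XY₁ hXY₁.1.1 (Finset.mem_powersetCard.1 hXY₁.2).1, keyB XY₂ hXY₂.1.1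
      (Finset.mem_powersetCard.1 hXY₂.2).1] at h2
    exact Prod.ext (Finset.coe_inj.1 h1) (Finset.coe_inj.1 h2)
  -- ruleLBig ≥ the sum over the pairs
  have hbig : ∑ XY ∈ I, 1 / ((eligCount M p q (S XY) : ℕ) : ℚ) ≤ ruleLBig M p q Z := by
    unfold ruleLBig
    have himg : I.image S ⊆ (cellY_finite M p q).toFinset := by
      intro T hT
      rw [Finset.mem_image] at hT
      obtain ⟨XY, hXY, rfl⟩ := hT
      rw [(cellY_finite M p q).mem_toFinset]
      exact (hcond XY hXY).1
    calc ∑ XY ∈ I, 1 / ((eligCount M p q (S XY) : ℕ) : ℚ)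
        = ∑ T ∈ I.image S,
            (if Z ⊆ T ∧ ¬ T.ncard < p ∧ (∃ e ∈ T, e ∉ Z ∧ M.eRk (insert e Z) = (q : ℕ∞)) then
              1 / ((eligCount M p q T : ℕ) : ℚ) else 0) := by
          rw [Finset.sum_image hinj]
          refine Finset.sum_congr rfl (fun XY hXY => ?_)
          rw [if_pos (hcond XY hXY).2.2]
      _ ≤ _ := Finset.sum_le_sum_of_subset_of_nonneg himg (fun T _ _ => by split_ifs <;> positivity)
  -- termwise: 1/eligCount ≥ 1/(c · C(q + #X_P, q))
  have hterm : ∀ XY ∈ I, 1 / ((c : ℚ) * (((q + XY.1.card).choose q : ℕ) : ℚ))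
      ≤ 1 / ((eligCount M p q (S XY) : ℕ) : ℚ) := by
    intro XY hXY
    have hXY' := hXY
    rw [hI, Finset.mem_product, Finset.mem_filter, Finset.mem_powerset] at hXY'
    have hle : eligCount M p q (S XY) ≤ c * (q + XY.1.card).choose q := by
      have := hH B hB hBcard hZB (XY.2 : Set α) (fun x hx => by
          have := (Finset.mem_powersetCard.1 hXY'.2).1 hx
          rwa [hBf, hBfin.mem_toFinset] at this) (hYcard XY.2 hXY'.2) (XY.1 : Set α)
        (hXPsub XY.1 hXY'.1.1) (Finset.coe_nonempty.2 hXY'.1.2)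
      rwa [Set.ncard_coe_finset] at this
    have hpos : 0 < eligCount M p q (S XY) := by
      unfold eligCount
      rw [Set.ncard_pos ((cellMembers_finite M p q).subset (fun _ h => h.1))]
      obtain ⟨hZS, -, e, heS, heZ, herk⟩ := (hcond XY hXY).2.2
      exact ⟨Z, hZ, hZS, e, heS, heZ, herk⟩
    have hposq : (0 : ℚ) < ((eligCount M p q (S XY) : ℕ) : ℚ) := by exact_mod_cast hpos
    refine one_div_le_one_div_of_le hposq ?_
    exact_mod_cast hle
  -- the pair sum in closed form: k copies of the X_P-sum, divided by c
  have hpairs : ∑ XY ∈ I, 1 / ((c : ℚ) * (((q + XY.1.card).choose q : ℕ) : ℚ))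
      = ((k : ℚ) / c) * ∑ X ∈ Pf.powerset.filter (fun X => X.Nonempty), 1 / (((q + X.card).choose q : ℕ) : ℚ) := by
    have hcardY : (Bf.powersetCard (k - 1)).card = k := by
      rw [Finset.card_powersetCard, hBfcard, ← Nat.choose_symm (by omega : k - 1 ≤ k),
        show k - (k - 1) = 1 by omega, Nat.choose_one_right]
    rw [hI, Finset.sum_product]
    simp only [Finset.sum_const, nsmul_eq_mul]
    rw [hcardY, Finset.mul_sum]
    refine Finset.sum_congr rfl (fun X _ => ?_)
    have hcpos : (0 : ℚ) < c := by exact_mod_cast hc1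
    field_simp
  -- the X_P-sum in closed form
  have hsum : ∑ X ∈ Pf.powerset.filter (fun X => X.Nonempty), 1 / (((q + X.card).choose q : ℕ) : ℚ)
      = ∑ i ∈ range m, (m.choose (i + 1) : ℚ) * (1 / (((q + (i + 1)).choose q : ℕ) : ℚ)) := by
    have h := sum_powerset_supported Pf (m + 1) (fun j => 1 / (((q + j).choose q : ℕ) : ℚ))
    rw [hPfcard, show m + 1 - 1 = m by omega] at h
    rw [← h, Finset.sum_filter]
    refine Finset.sum_congr rfl (fun X hX => ?_)
    rw [Finset.mem_powerset] at hX
    have hXle : X.card ≤ m := by rw [← hPfcard]; exact Finset.card_le_card hX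
    by_cases hne : X.Nonempty
    · rw [if_pos hne, if_pos ⟨Finset.card_pos.2 hne, by omega⟩]
    · rw [if_neg hne, if_neg (fun h => hne (Finset.card_pos.1 h.1))]
  -- δ(Z) ≤ the closed form
  have hdelta : lymDefect M p q Z ≤ ∑ i ∈ range m, (m.choose (i + 1) : ℚ) * (1 / (((q + (i + 1)).choose q : ℕ) : ℚ)) := by
    unfold lymDefect
    rw [← hm]
    have hL : ∑ i ∈ range (p - q - 1), (m.choose (i + 1) : ℚ) / ((q + i + 1).choose q : ℚ)
        ≤ ∑ i ∈ range (p - q - 1 + m), (m.choose (i + 1) : ℚ) / ((q + i + 1).choose q : ℚ) := by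
      refine Finset.sum_le_sum_of_subset_of_nonneg (by
        intro x hx
        rw [Finset.mem_range] at hx ⊢
        omega) (fun i _ _ => by positivity)
    have h1 : ∀ i : ℕ, (m.choose (i + 1) : ℚ) * (1 / (((q + (i + 1)).choose q : ℕ) : ℚ))
        = (m.choose (i + 1) : ℚ) / ((q + i + 1).choose q : ℚ) := by
      intro i
      rw [show q + (i + 1) = q + i + 1 by ring, mul_one_div]
    have hR : ∑ i ∈ range m, (m.choose (i + 1) : ℚ) * (1 / (((q + (i + 1)).choose q : ℕ) : ℚ))
        = ∑ i ∈ range (p - q - 1 + m), (m.choose (i + 1) : ℚ) / ((q + i + 1).choose q : ℚ) := by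
      simp only [h1]
      refine Finset.sum_subset (by
        intro x hx
        rw [Finset.mem_range] at hx ⊢
        omega) (fun i hi hi' => ?_)
      rw [Finset.mem_range] at hi hi'
      rw [Nat.choose_eq_zero_of_lt (by omega)]
      simp
    rw [hR]
    exact hL
  have hkc : (1 : ℚ) ≤ (k : ℚ) / c := by
    rw [le_div_iff₀ (by exact_mod_cast hc1 : (0 : ℚ) < c), one_mul]
    exact_mod_cast hck
  have hsum_nonneg : 0 ≤ ∑ X ∈ Pf.powerset.filter (fun X => X.Nonempty), 1 / (((q + X.card).choose q : ℕ) : ℚ) :=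
    Finset.sum_nonneg (fun X _ => by positivity)
  calc lymDefect M p q Z ≤ _ := hdelta
    _ = ∑ X ∈ Pf.powerset.filter (fun X => X.Nonempty), 1 / (((q + X.card).choose q : ℕ) : ℚ) := hsum.symm
    _ ≤ ((k : ℚ) / c) * ∑ X ∈ Pf.powerset.filter (fun X => X.Nonempty), 1 / (((q + X.card).choose q : ℕ) : ℚ) :=
        le_mul_of_one_le_left hsum_nonneg hkc
    _ = ∑ XY ∈ I, 1 / ((c : ℚ) * (((q + XY.1.card).choose q : ℕ) : ℚ)) := hpairs.symm
    _ ≤ ∑ XY ∈ I, 1 / ((eligCount M p q (S XY) : ℕ) : ℚ) := Finset.sum_le_sum hterm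
    _ ≤ ruleLBig M p q Z := hbig

/-- **Rule L pays every member with `c`-bounded eligibility on its big sets** (`1 ≤ c ≤ p − q`, tight layer). -/
theorem ruleL_pays_of_bound (p q : ℕ) (hE : M.E.ncard = p + q) (hpq : q + 2 ≤ p) {Z : Set α}
    (hZ : Z ∈ cellMembers M p q) (c : ℕ) (hc1 : 1 ≤ c) (hck : c ≤ p - q)
    (hH : ∀ B ⊆ M.E \ M.closure Z, B.ncard = p - q → M.Indep (Z ∪ B) →
      ∀ Y ⊆ B, Y.ncard = p - q - 1 → ∀ X_P ⊆ flatPart M Z, X_P.Nonempty →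
        eligCount M p q (Z ∪ X_P ∪ Y) ≤ c * (q + X_P.ncard).choose q) :
    phiK p q ≤ ruleLRecv M p q Z := by
  rw [ruleLRecv_eq M p q hE (by omega) hZ]
  have := lymDefect_le_ruleLBig_of_bound M p q hE hpq hZ c hc1 hck hH
  linarith

end PercRepro
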